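import Summits.QuantumFields.BalabanUV.Beta.EriceRemainderEnclosureHistoryAutonomyComparisonAffineProfile

/-!
# EriceRemainderEnclosureHistoryAutonomyComparisonAffineProfileEnd — (E58c) THE CLASSES COVERED BY THE PROFILE CONDITION OF (E58b): the two-loop-shaped
# memory `b + c·u_0² + Σ_{k<K} L_k·u_k` (`le_of_isotone_excess_quadratic_affine_profile`), affine memories with ALL MEMORY AGES WITHIN A FACTOR 3 of each other
# (`le_of_isotone_excess_affine_window`), and affine memories DOMINATED BY THEIR MARKOV TERM, `Σ_{k<K} L_k ≤ 3·L_0` (`le_of_isotone_excess_affine_markov`) —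
# each compares under every isotone excess with a zeroth moment, at ANY size, from every pin

Cell `pub-balaban`, β-function sub-cell, BINDER row D4 «RemainderConst leaves for Bałaban's split» (`HOME/BINDER-OWNERS.md`; owner lineage `b2b-balaban-beta-an4`;
this file by co-owner #2 lineage `b2b-balaban-beta-d4-p2`, generation 51), β-FLOW TEAM duty (1), FREEZE (0) honoured (def-free; (E58b)'s
`le_of_isotone_excess_dom_profile` ∕ `le_of_isotone_excess_affine_profile` and (E41)'s `affine_monotone` ∕ `affine_floor` ∕ `affine_zerothMoment` BY NAME; the
functionals are displayed lambda terms; nothing restated).  Third file of STATION (E58) after (E58a) `…ComparisonPrinciple` (the induction with THE STEP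
abstracted) and (E58b) `…ComparisonAffineProfile` (the trajectory-free profile condition `Σ_{j<K} L_j ∕ P_j ≤ 2`, `P_j = Σ_{k<K} L_k·√(j∕(j+k))`).

HONEST FRAMING (page 1, verbatim and binding).  *"Discharging BetaPertH makes Bałaban's UV stability UNCONDITIONAL — a real constructive-QFT result; it is
NOT the continuum limit and NOT the Clay problem."*  THIS FILE DISCHARGES NOTHING OF THE KIND.  Elementary real analysis about ABSTRACT functionals on a box
]0,γ]^ℕ with displayed signs — hypotheses of a census, not facts; the form, signs, moments and age profile of Bałaban's (1.22) limit functional are NOT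
PRINTED ([I] p. 298; GAPS G-t4-U2-1∕-2) and NOT asserted; `b + c·u_0² + Σ_k L_k·u_k` is an ILLUSTRATION of the class (the shape of a two-loop Markov term
plus a linear memory), not a claim about Erice (3.73).  Row D4 class UNCHANGED (critical-path width 0; instance 0∕1; D4 DISCHARGE NO DATE).  HONEST DEPENDENCY:
continuum YM on T⁴ ⇐ BetaPertH ∧ nine spine estimates (0/9 proved); BetaPertH ⇐ (D1) ∧ (D4) ∧ CAP+tail; G-an2-4 gates asym, D1 and NE2/3/4.

THE POINT (census sense (α); the COMPARISON column after STATION (E58)).  A zeroth moment alone buys comparison exactly up to `M·γ = 3√3·b` ((E49k), sharp by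
(E56b)); ONE affine age buys it at any size ((E57a)∕(E57b)); SEVERAL affine ages buy it at any size whenever the profile passes `Σ_j L_j ∕ P_j ≤ 2` ((E58b)) —
in particular (this file): §1 any memory `b + c·u_0² + Σ_{k<K} L_k·u_k` with `c ≥ 0` and a passing profile (the Markov part is free: it is invisible to the drop
at a common pin and only enlarges `P_j`); §2 every affine memory whose memory ages `k ≥ 1` lie in a window `[K₀, 3K₀]` (`j∕(j+k) ≥ 1∕4` there, so
`P_j ≥ ½·Σ_k L_k`), with or without a Markov term, WHATEVER the sizes `L_k`; §3 every affine memory with `Σ_{k<K} L_k ≤ 3·L_0` (`P_j ≥ L_0` for `j ≥ 1`),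
WHATEVER the ages.  Numerically (`HOME/b2b-balaban-beta-d4-p2/g51/e58/profile_check.py`) every UNIFORM window `(M∕K)·Σ_{1≤k≤K} u_k` passes as well
(`Σ_j L_j∕P_j` increasing in `K`, `1.61` at `K = 300`, heuristic limit `≈ 1.65`) — not typed (finite-`K` square-root sums).  OPEN (see (E58b)'s header):
comparison for ALL affine profiles at any size (conjectured true; the level-weight bookkeeping provably cannot decide it).

WHAT IS PROVED ([folklore]; 0 `def`, 0 sorry).  §1 **`le_of_isotone_excess_quadratic_affine_profile`**.  §2 **`le_of_isotone_excess_affine_window`**.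
§3 **`le_of_isotone_excess_affine_markov`**.
-/
noncomputable section
open Finset Set

namespace Summit.QuantumFields.BalabanUV.Beta.EriceRemainderEnclosureHistoryAutonomyComparisonAffineProfileEnd

open Literature.MathematicalPhysics.QuantumFieldTheory.Balaban1983to89
open Literature.MathematicalPhysics.QuantumFieldTheory.Balaban1983to89.T4BetaStationary
open Literature.MathematicalPhysics.QuantumFieldTheory.Balaban1983to89.T4BetaFlowWellPosed
open Summit.QuantumFields.BalabanUV.Beta.EriceRemainderEnclosureHistoryAutonomyComparisonAffineProfile
  (le_of_isotone_excess_dom_profile le_of_isotone_excess_affine_profile)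
open Summit.QuantumFields.BalabanUV.Beta.EriceRemainderEnclosureHistoryAutonomyMonotone (affine_monotone affine_floor affine_zerothMoment)

variable {B' : (ℕ → ℝ) → ℝ} {M' γ b y : ℝ} {L : ℕ → ℝ} {K : ℕ} {h h' : ℕ → ℝ}

/-! ## §1 The two-loop-shaped memory `b + c·u_0² + Σ_{k<K} L_k·u_k` -/

/-- **`b + c·u_0² + Σ_{k<K} L_k·u_k` COMPARES UNDER EVERY ISOTONE EXCESS AT ANY SIZE WHEN THE PROFILE PASSES** (`b > 0`, `c ≥ 0`, `L_k ≥ 0` of any sizes,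
`Σ_{j<K} L_j ∕ P_j ≤ 2`): on ]0,γ] it is isotone, has zeroth moment `Σ_k L_k + 2cγ` and floor `b`, is dominated by the profile and Lipschitz along it at fixed
newest entry (equality); so (E58b) `le_of_isotone_excess_dom_profile` applies: for every `B′ ≥ B` with a zeroth moment and an isotone excess, ANY box solutions
from one pin satisfy `h′ ≤ h` at every scale. [folklore] -/
theorem le_of_isotone_excess_quadratic_affine_profile {c p : ℝ} (hc : 0 ≤ c) (hL : ∀ k, 0 ≤ L k) (hb : 0 < b) (hγ : 0 < γ)
    (hP : ∑ j ∈ range K, L j / ∑ k ∈ range K, L k * Real.sqrt ((j : ℝ) / ((j : ℝ) + k)) ≤ 2)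
    (hB' : ∀ u u' : ℕ → ℝ, SeqBox γ u → SeqBox γ u' → ∀ D : ℝ, (∀ j, |u j - u' j| ≤ D) → |B' u - B' u'| ≤ M' * D) (hM' : 0 ≤ M')
    (hexc : ∀ u, SeqBox γ u → (fun w : ℕ → ℝ => b + c * w 0 ^ 2 + ∑ k ∈ range K, L k * w k) u ≤ B' u)
    (hDmono : ∀ u v : ℕ → ℝ, SeqBox γ u → SeqBox γ v → (∀ j, u j ≤ v j) →
      B' u - (fun w : ℕ → ℝ => b + c * w 0 ^ 2 + ∑ k ∈ range K, L k * w k) u ≤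
        B' v - (fun w : ℕ → ℝ => b + c * w 0 ^ 2 + ∑ k ∈ range K, L k * w k) v)
    (hp : 0 < p) (hpγ : p ≤ γ) (hh : SeqBox γ h) (hf : MemFlow (fun w : ℕ → ℝ => b + c * w 0 ^ 2 + ∑ k ∈ range K, L k * w k) p h)
    (hh' : SeqBox γ h') (hf' : MemFlow B' p h') (j : ℕ) : h' j ≤ h j := by
  have hmono := affine_monotone (γ := γ) (b₀ := b) (K := K) hL
  have hzm := affine_zerothMoment (γ := γ) (b₀ := b) (K := K) hL
  refine le_of_isotone_excess_dom_profile (B := fun w : ℕ → ℝ => b + c * w 0 ^ 2 + ∑ k ∈ range K, L k * w k)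
    (M := ∑ k ∈ range K, L k + 2 * c * γ) ?_ ?_ (add_nonneg (sum_nonneg fun k _ => hL k) (by positivity)) hL hb ?_ ?_ ?_ hP hB' hM' hexc hDmono
    hp hpγ hh hf hh' hf' j
  · intro u v hu hv huv
    have h0 := huv 0; have hu0 := (hu 0).1
    have hq : c * u 0 ^ 2 ≤ c * v 0 ^ 2 := mul_le_mul_of_nonneg_left (by nlinarith) hc
    have hs := hmono u v hu hv huv
    linarith
  · intro u u' hu hu' D hD
    have e : b + c * u 0 ^ 2 + ∑ k ∈ range K, L k * u k - (b + c * u' 0 ^ 2 + ∑ k ∈ range K, L k * u' k)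
        = c * ((u 0 + u' 0) * (u 0 - u' 0)) + ((b + ∑ k ∈ range K, L k * u k) - (b + ∑ k ∈ range K, L k * u' k)) := by ring
    rw [e]
    have hsum : |u 0 + u' 0| ≤ 2 * γ := by
      rw [abs_of_pos (by linarith [(hu 0).1, (hu' 0).1])]; linarith [(hu 0).2, (hu' 0).2]
    calc |c * ((u 0 + u' 0) * (u 0 - u' 0)) + ((b + ∑ k ∈ range K, L k * u k) - (b + ∑ k ∈ range K, L k * u' k))|
        ≤ |c * ((u 0 + u' 0) * (u 0 - u' 0))| + |(b + ∑ k ∈ range K, L k * u k) - (b + ∑ k ∈ range K, L k * u' k)| := abs_add_le _ _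
      _ ≤ c * (2 * γ * D) + (∑ k ∈ range K, L k) * D := by
          refine add_le_add ?_ (hzm u u' hu hu' D hD)
          rw [abs_mul, abs_mul, abs_of_nonneg hc]
          exact mul_le_mul_of_nonneg_left (mul_le_mul hsum (hD 0) (abs_nonneg _) (by positivity)) hc
      _ = (∑ k ∈ range K, L k + 2 * c * γ) * D := by ring
  · intro u hu
    have := affine_floor (γ := γ) (b₀ := b) (K := K) hL u hu
    nlinarith [sq_nonneg (u 0)]
  · intro u hu; nlinarith [sq_nonneg (u 0), hb]
  · intro u u' _ _ _ h0
    rw [h0, show b + c * u 0 ^ 2 + ∑ k ∈ range K, L k * u k - (b + c * u 0 ^ 2 + ∑ k ∈ range K, L k * u' k)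
      = ∑ k ∈ range K, L k * u k - ∑ k ∈ range K, L k * u' k by ring, ← sum_sub_distrib]
    exact le_of_eq (sum_congr rfl fun k _ => by ring)

/-! ## §2 All memory ages within a factor 3 of each other -/

/-- **ALL MEMORY AGES WITHIN A FACTOR 3 OF EACH OTHER ⟹ COMPARISON AT ANY SIZE** (a Markov term `L_0·u_0` may ride along).  If the weights
`L_k`, `k ≥ 1`, vanish outside a window `K₀ ≤ k ≤ 3K₀` (`K₀ ≥ 1`), the profile condition holds (`j∕(j+k) ≥ 1∕4` on the window and `= 1` for `k = 0`, so
`P_j ≥ ½·Σ_k L_k` for every age `j` of the window, while the `j = 0` summand vanishes), hence every `B′ ≥ B` with a zeroth moment and an isotone excess has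
`h′ ≤ h` at every scale from every pin — for EVERY family of sizes `L_k ≥ 0`. [folklore] -/
theorem le_of_isotone_excess_affine_window {p : ℝ} {K₀ : ℕ} (hL : ∀ k, 0 ≤ L k) (hb : 0 < b) (hK₀ : 1 ≤ K₀)
    (hwin : ∀ k, k ≠ 0 → L k ≠ 0 → K₀ ≤ k ∧ k ≤ 3 * K₀)
    (hB' : ∀ u u' : ℕ → ℝ, SeqBox γ u → SeqBox γ u' → ∀ D : ℝ, (∀ j, |u j - u' j| ≤ D) → |B' u - B' u'| ≤ M' * D) (hM' : 0 ≤ M')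
    (hexc : ∀ u, SeqBox γ u → (fun u : ℕ → ℝ => b + ∑ k ∈ range K, L k * u k) u ≤ B' u)
    (hDmono : ∀ u v : ℕ → ℝ, SeqBox γ u → SeqBox γ v → (∀ j, u j ≤ v j) →
      B' u - (fun u : ℕ → ℝ => b + ∑ k ∈ range K, L k * u k) u ≤ B' v - (fun u : ℕ → ℝ => b + ∑ k ∈ range K, L k * u k) v)
    (hp : 0 < p) (hpγ : p ≤ γ) (hh : SeqBox γ h) (hf : MemFlow (fun u : ℕ → ℝ => b + ∑ k ∈ range K, L k * u k) p h)
    (hh' : SeqBox γ h') (hf' : MemFlow B' p h') (j : ℕ) : h' j ≤ h j := by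
  refine le_of_isotone_excess_affine_profile hL hb ?_ hB' hM' hexc hDmono hp hpγ hh hf hh' hf' j
  set T : ℝ := ∑ k ∈ range K, L k with hT_def
  have hT0 : 0 ≤ T := sum_nonneg fun k _ => hL k
  -- each summand is at most 2·L_i/T (and 0 when L_i = 0 or i = 0)
  have hterm : ∀ i ∈ range K, L i / ∑ k ∈ range K, L k * Real.sqrt ((i : ℝ) / ((i : ℝ) + k)) ≤ 2 * L i / T := by
    intro i hi
    rcases (hL i).eq_or_lt with hLi | hLi
    · rw [← hLi]; simp
    have hTpos : 0 < T := lt_of_lt_of_le hLi (single_le_sum (f := L) (fun k _ => hL k) hi)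
    rcases Nat.eq_zero_or_pos i with rfl | hipos
    · have hP0 : ∑ k ∈ range K, L k * Real.sqrt (((0 : ℕ) : ℝ) / (((0 : ℕ) : ℝ) + k)) = 0 :=
        sum_eq_zero fun k _ => by simp
      rw [hP0, div_zero]; positivity
    have hwi := hwin i hipos.ne' hLi.ne'
    have hir : (K₀ : ℝ) ≤ i := by exact_mod_cast hwi.1
    have hK₀r : (1 : ℝ) ≤ K₀ := by exact_mod_cast hK₀
    -- P_i ≥ T/2
    have hPi : T / 2 ≤ ∑ k ∈ range K, L k * Real.sqrt ((i : ℝ) / ((i : ℝ) + k)) := by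
      rw [hT_def, sum_div]
      refine sum_le_sum fun k _ => ?_
      rcases (hL k).eq_or_lt with hLk | hLk
      · rw [← hLk]; simp
      have hquarter : (1 : ℝ) / 4 ≤ (i : ℝ) / ((i : ℝ) + k) := by
        rcases Nat.eq_zero_or_pos k with rfl | hkpos
        · rw [Nat.cast_zero, add_zero, div_self (by linarith)]; norm_num
        have hwk := hwin k hkpos.ne' hLk.ne'
        have hkr : (k : ℝ) ≤ 3 * K₀ := by exact_mod_cast hwk.2
        rw [div_le_div_iff₀ (by norm_num) (by linarith [hir, hK₀r, (Nat.cast_nonneg k : (0:ℝ) ≤ k)])]; nlinarith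
      have hhalf : (1 : ℝ) / 2 ≤ Real.sqrt ((i : ℝ) / ((i : ℝ) + k)) := by
        rw [show (1 : ℝ) / 2 = Real.sqrt ((1 / 2) ^ 2) by rw [Real.sqrt_sq (by norm_num)]]
        exact Real.sqrt_le_sqrt (by norm_num at hquarter ⊢; linarith)
      calc L k / 2 = L k * (1 / 2) := by ring
        _ ≤ L k * Real.sqrt ((i : ℝ) / ((i : ℝ) + k)) := mul_le_mul_of_nonneg_left hhalf (hL k)
    rw [div_le_div_iff₀ (lt_of_lt_of_le (half_pos hTpos) hPi) hTpos]
    nlinarith [hPi, hLi.le]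
  calc ∑ i ∈ range K, L i / ∑ k ∈ range K, L k * Real.sqrt ((i : ℝ) / ((i : ℝ) + k))
      ≤ ∑ i ∈ range K, 2 * L i / T := sum_le_sum hterm
    _ = 2 * T / T := by rw [hT_def, ← sum_div, mul_sum]
    _ ≤ 2 := by
        rcases hT0.eq_or_lt with hT | hT
        · rw [← hT]; simp
        · rw [mul_div_assoc, div_self hT.ne', mul_one]

/-! ## §3 Memories dominated by their Markov term -/

/-- **MEMORIES DOMINATED BY THEIR MARKOV TERM COMPARE AT ANY SIZE**: if `Σ_{k<K} L_k ≤ 3·L_0` (the memory ages `k ≥ 1` weigh in total at most twice the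
coefficient of the newest coupling `u_0`), the profile condition holds (`P_j ≥ L_0` for `j ≥ 1`), hence `h′ ≤ h` at every scale from every pin under every
isotone excess with a zeroth moment — WHATEVER the ages and sizes. [folklore] -/
theorem le_of_isotone_excess_affine_markov {p : ℝ} (hL : ∀ k, 0 ≤ L k) (hb : 0 < b) (hdom : ∑ k ∈ range K, L k ≤ 3 * L 0)
    (hB' : ∀ u u' : ℕ → ℝ, SeqBox γ u → SeqBox γ u' → ∀ D : ℝ, (∀ j, |u j - u' j| ≤ D) → |B' u - B' u'| ≤ M' * D) (hM' : 0 ≤ M')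
    (hexc : ∀ u, SeqBox γ u → (fun u : ℕ → ℝ => b + ∑ k ∈ range K, L k * u k) u ≤ B' u)
    (hDmono : ∀ u v : ℕ → ℝ, SeqBox γ u → SeqBox γ v → (∀ j, u j ≤ v j) →
      B' u - (fun u : ℕ → ℝ => b + ∑ k ∈ range K, L k * u k) u ≤ B' v - (fun u : ℕ → ℝ => b + ∑ k ∈ range K, L k * u k) v)
    (hp : 0 < p) (hpγ : p ≤ γ) (hh : SeqBox γ h) (hf : MemFlow (fun u : ℕ → ℝ => b + ∑ k ∈ range K, L k * u k) p h)
    (hh' : SeqBox γ h') (hf' : MemFlow B' p h') (j : ℕ) : h' j ≤ h j := by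
  refine le_of_isotone_excess_affine_profile hL hb ?_ hB' hM' hexc hDmono hp hpγ hh hf hh' hf' j
  rcases Nat.eq_zero_or_pos K with rfl | hKpos
  · simp
  have h0K : 0 ∈ range K := mem_range.mpr hKpos
  rcases (hL 0).eq_or_lt with hL0 | hL0
  · -- L 0 = 0 forces every weight to vanish
    have hall : ∀ k ∈ range K, L k = 0 := by
      have hs : ∑ k ∈ range K, L k = 0 := le_antisymm (by rw [← hL0, mul_zero] at hdom; exact hdom) (sum_nonneg fun k _ => hL k)
      exact (sum_eq_zero_iff_of_nonneg fun k _ => hL k).mp hs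
    rw [sum_eq_zero fun i hi => by rw [hall i hi, zero_div]]
    norm_num
  -- each summand with j ≥ 1 is at most L_j / L_0; the j = 0 summand vanishes
  have hterm : ∀ i ∈ range K, L i / ∑ k ∈ range K, L k * Real.sqrt ((i : ℝ) / ((i : ℝ) + k)) ≤
      (if i = 0 then 0 else L i / L 0) := by
    intro i hi
    rcases Nat.eq_zero_or_pos i with rfl | hipos
    · have hP0 : ∑ k ∈ range K, L k * Real.sqrt (((0 : ℕ) : ℝ) / (((0 : ℕ) : ℝ) + k)) = 0 :=
        sum_eq_zero fun k _ => by simp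
      rw [hP0]; simp
    rw [if_neg hipos.ne']
    have hir : (0 : ℝ) < i := by exact_mod_cast hipos
    have hPi : L 0 ≤ ∑ k ∈ range K, L k * Real.sqrt ((i : ℝ) / ((i : ℝ) + k)) := by
      have h1 : L 0 * Real.sqrt ((i : ℝ) / ((i : ℝ) + ((0 : ℕ) : ℝ))) = L 0 := by
        rw [Nat.cast_zero, add_zero, div_self hir.ne', Real.sqrt_one, mul_one]
      rw [← h1]
      exact single_le_sum (f := fun k => L k * Real.sqrt ((i : ℝ) / ((i : ℝ) + k)))
        (fun k _ => mul_nonneg (hL k) (Real.sqrt_nonneg _)) h0K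
    exact div_le_div_of_nonneg_left (hL i) hL0 hPi
  refine (sum_le_sum hterm).trans ?_
  -- Σ_{i<K, i≠0} L_i / L_0 = (Σ_{i<K} L_i)/L_0 − 1 ≤ 2
  have e1 := (sum_erase_add (range K) (fun i => if i = 0 then (0 : ℝ) else L i / L 0) h0K).symm
  have e2 := (sum_erase_add (range K) (fun i => L i / L 0) h0K).symm
  have e3 : ∑ i ∈ (range K).erase 0, (if i = 0 then (0 : ℝ) else L i / L 0) = ∑ i ∈ (range K).erase 0, L i / L 0 :=
    sum_congr rfl fun i hi => by rw [if_neg (mem_erase.mp hi).1]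
  rw [e1, e3, if_pos rfl, add_zero]
  have e4 : ∑ i ∈ (range K).erase 0, L i / L 0 = (∑ i ∈ range K, L i) / L 0 - 1 := by
    rw [sum_div, e2, div_self hL0.ne']; ring
  rw [e4, div_sub_one hL0.ne', div_le_iff₀ hL0]
  linarith

end Summit.QuantumFields.BalabanUV.Beta.EriceRemainderEnclosureHistoryAutonomyComparisonAffineProfileEnd

end
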